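import Mathlib

/-!
# `BalabanUV.Beta.FP.ShotBridge` — roads «FP» (d1-p3) and «BF-x» (d1-p2) for binder row D1: THE CROSS-ROAD BRIDGE (owner ruling R-FP-14)
# — the two roads' hard analytic leaves are inter-derivable modulo the shared bookkeeping; pure real analysis, no road object

HONEST FRAMING (cell contract, verbatim): «discharging `BetaPertH` makes Bałaban's UV stability UNCONDITIONAL — a real constructive-QFT
result; it is NOT the continuum limit and NOT the Clay problem.»  THIS MODULE DISCHARGES NOTHING: it is elementary real analysis about
four abstract sequences.  READING (header only, never a hypothesis): `F₀ (Lc^k)` = road BF-x's level-0 one-shot coefficient at blocking `Lc^k`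
(`shotCoeff`), `f j m` = the (1.22) coefficient of road FP's finite-level (j, m) family (m more steps from level j), `δ j m` = the read-out defect of
the TWO-STAGE telescoping `F₀(Lc^(j+m)) = F₀(Lc^j) + f j m + δ j m` (an4's step-recursion / (SDF) algebra, two-stage form), `fP m` = road FP's perfect
coefficient `fPerfG … m` (the `j → ∞` limit, X1m).  CONTENT:
* §1 `abs_sub_le_of_shot_twoStage`, **`hasym_of_shot_twoStage`** — BF-x's level-0 law in bounded form `|F₀(Lc^k) − k·s| ≤ C` + two-stage
  telescoping with `|δ j m| ≤ D` + entrywise convergence `f j m → fP m` ⟹ road FP's (ASYMP) `∀ m ≥ 1, |fP m − m·s| ≤ 2C + D`.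
* §2 **`shot_bounded_of_value_rate`** — conversely, road FP's VALUE + the X1 geometric rate `|β j − s| ≤ c·θ^j` + the one-stage telescoping
  `F₀(Lc^k) = Σ_{j<k} β j + ε k` with `|ε k| ≤ E` ⟹ BF-x's law `|F₀(Lc^k) − k·s| ≤ c/(1−θ) + E`.
So T (BF-x, level 0, Wilson legs) and N7 (FP, level ∞, perfect legs) are ONE analytic debt seen at two levels: whichever closes first closes the
other modulo {two-stage / one-stage telescoping defects bounded (an4 / (SDF) lane), X1 / X1m (G-an2-4)}; they stay mutually cross-checking
(different explicit objects, same `κ`).  Road FP's distinctive output — the EXACT identification `fP 1 = s` by the step law — is NOT given by T.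
NOT «D1 closed», NOT BetaPertH, NOT continuum, NOT Clay.  [our object], Mathlib only, 0 `def`, 0 cite, 0 sorry.
HONEST DEPENDENCY (verbatim): «continuum YM on T⁴ ⇐ BetaPertH ∧ nine spine estimates (0/9 proved); BetaPertH ⇐ (D1) ∧ (D4) ∧ CAP+tail;
G-an2-4 gates asym, D1 and NE2/3/4.»
Provenance: road FP owner b2b-balaban-beta-d1-p3 gen 3, 2026-08-20 (claim table `LEAVES-FP.md` row FP-BFX-BRIDGE).
-/

namespace Summit.QuantumFields.BalabanUV.Beta.FP.ShotBridge

open Filter Topology Finset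

/-! ## §1 Level-0 one-shot law + two-stage telescoping ⟹ the perfect family's (ASYMP) -/

/-- [our object] **FINITE-LEVEL FORM**: the level-0 law in bounded form, the two-stage telescoping identity and a bound on its defect give
`|f j m − m·s| ≤ 2C + D` for EVERY `j, m`. -/
theorem abs_sub_le_of_shot_twoStage {F₀ : ℕ → ℝ} {f δ : ℕ → ℕ → ℝ} {s C D : ℝ} {L : ℕ}
    (hT : ∀ k : ℕ, |F₀ (L ^ k) - (k : ℝ) * s| ≤ C)
    (htel : ∀ j m : ℕ, F₀ (L ^ (j + m)) = F₀ (L ^ j) + f j m + δ j m)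
    (hδ : ∀ j m : ℕ, |δ j m| ≤ D) (j m : ℕ) :
    |f j m - (m : ℝ) * s| ≤ 2 * C + D := by
  have h1 := hT (j + m)
  have h2 := hT j
  have h3 := hδ j m
  have e : f j m - (m : ℝ) * s
      = (F₀ (L ^ (j + m)) - ((j + m : ℕ) : ℝ) * s) - (F₀ (L ^ j) - (j : ℝ) * s) - δ j m := by
    rw [htel j m]; push_cast; ring
  rw [e]
  calc |F₀ (L ^ (j + m)) - ((j + m : ℕ) : ℝ) * s - (F₀ (L ^ j) - (j : ℝ) * s) - δ j m|
      ≤ |F₀ (L ^ (j + m)) - ((j + m : ℕ) : ℝ) * s - (F₀ (L ^ j) - (j : ℝ) * s)| + |δ j m| := abs_sub _ _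
    _ ≤ (|F₀ (L ^ (j + m)) - ((j + m : ℕ) : ℝ) * s| + |F₀ (L ^ j) - (j : ℝ) * s|) + |δ j m| := by
        gcongr; exact abs_sub _ _
    _ ≤ (C + C) + D := by gcongr
    _ = 2 * C + D := by ring

/-- [our object] **ROAD FP's (ASYMP) FROM ROAD BF-x's LEVEL-0 LAW**: under entrywise convergence `f j m → fP m` (X1m), the finite-level form passes to
the limit: `∀ m ≥ 1, |fP m − m·s| ≤ 2C + D`.  (The hypothesis `1 ≤ m` is not used; it is kept to match the road's `hasym` shape.) -/
theorem hasym_of_shot_twoStage {F₀ : ℕ → ℝ} {f δ : ℕ → ℕ → ℝ} {fP : ℕ → ℝ} {s C D : ℝ} {L : ℕ}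
    (hT : ∀ k : ℕ, |F₀ (L ^ k) - (k : ℝ) * s| ≤ C)
    (htel : ∀ j m : ℕ, F₀ (L ^ (j + m)) = F₀ (L ^ j) + f j m + δ j m)
    (hδ : ∀ j m : ℕ, |δ j m| ≤ D) (hlim : ∀ m : ℕ, Tendsto (fun j => f j m) atTop (𝓝 (fP m))) :
    ∀ m : ℕ, 1 ≤ m → |fP m - (m : ℝ) * s| ≤ 2 * C + D := by
  intro m _
  have hc : Tendsto (fun j => |f j m - (m : ℝ) * s|) atTop (𝓝 (|fP m - (m : ℝ) * s|)) :=
    ((hlim m).sub_const _).abs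
  exact le_of_tendsto' hc fun j => abs_sub_le_of_shot_twoStage hT htel hδ j m

/-! ## §2 The converse: road FP's value + geometric rate + one-stage telescoping ⟹ road BF-x's law -/

/-- [our object] Partial sums of a geometric majorant: `Σ_{j<k} c·θ^j ≤ c/(1−θ)` for `0 ≤ c`, `0 ≤ θ < 1`. -/
theorem sum_geometric_majorant_le {c θ : ℝ} (hc : 0 ≤ c) (hθ0 : 0 ≤ θ) (hθ1 : θ < 1) (k : ℕ) :
    ∑ j ∈ range k, c * θ ^ j ≤ c / (1 - θ) := by
  have hgeo := hasSum_geometric_of_lt_one hθ0 hθ1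
  have hle : ∑ j ∈ range k, θ ^ j ≤ (1 - θ)⁻¹ :=
    sum_le_hasSum (range k) (fun j _ => pow_nonneg hθ0 j) hgeo
  rw [← mul_sum, div_eq_mul_inv]
  exact mul_le_mul_of_nonneg_left hle hc

/-- [our object] **ROAD BF-x's LEVEL-0 LAW FROM ROAD FP's VALUE**: if the one-step coefficients satisfy `|β j − s| ≤ c·θ^j` (road FP's value `s` +
the X1 geometric rate) and the level-0 one-shot telescopes as `F₀(Lc^k) = Σ_{j<k} β j + ε k` with `|ε k| ≤ E` (one-stage telescoping, bounded
cumulative defect), then `|F₀(Lc^k) − k·s| ≤ c/(1−θ) + E` for every `k`. -/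
theorem shot_bounded_of_value_rate {F₀ β ε : ℕ → ℝ} {s c θ E : ℝ} {L : ℕ}
    (hβ : ∀ j : ℕ, |β j - s| ≤ c * θ ^ j) (hc : 0 ≤ c) (hθ0 : 0 ≤ θ) (hθ1 : θ < 1)
    (htel : ∀ k : ℕ, F₀ (L ^ k) = ∑ j ∈ range k, β j + ε k) (hε : ∀ k : ℕ, |ε k| ≤ E) (k : ℕ) :
    |F₀ (L ^ k) - (k : ℝ) * s| ≤ c / (1 - θ) + E := by
  have e : F₀ (L ^ k) - (k : ℝ) * s = ∑ j ∈ range k, (β j - s) + ε k := by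
    rw [htel k, sum_sub_distrib, sum_const, card_range, nsmul_eq_mul]; ring
  rw [e]
  calc |∑ j ∈ range k, (β j - s) + ε k|
      ≤ |∑ j ∈ range k, (β j - s)| + |ε k| := abs_add_le _ _
    _ ≤ ∑ j ∈ range k, |β j - s| + |ε k| := by gcongr; exact abs_sum_le_sum_abs _ _
    _ ≤ ∑ j ∈ range k, c * θ ^ j + E := by
        gcongr with j _
        · exact hβ j
        · exact hε k
    _ ≤ c / (1 - θ) + E := by gcongr; exact sum_geometric_majorant_le hc hθ0 hθ1 k

end Summit.QuantumFields.BalabanUV.Beta.FP.ShotBridge
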